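import Literature.AlgebraicGeometry.HodgeTheory.LimitMixedHodgeStructureSl2Triple
import Literature.Algebra.Lie.LefschetzSubmodule
import HarnessLib

/-!
# Naturality of the `𝔰𝔩₂`-triple `(N⁺, H, N)` of a limit mixed Hodge structure

The triple `(N⁺, H, N_ℂ)` of `Literature/AlgebraicGeometry/HodgeTheory/LimitMixedHodgeStructureSl2Triple.lean`
(Cattani–El Zein–Griffiths–Lê, *Hodge Theory*, §7.5 (7.5.13)–(7.5.14); Kerr–Pearlstein, MSRI Publ. 58, §4.2) is
determined by `(H, N_ℂ)`: `N⁺` is the Jacobson–Morozov partner of the Lefschetz operator `N_ℂ` for the grading `-H`,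
and "this `f` is then unique" (Looijenga–Lunts, §1 (1.1)). Uniqueness upgrades to NATURALITY: every linear map
intertwining `(H₁, N₁)` with `(H₂, N₂)` intertwines `N₁⁺` with `N₂⁺` (the tree's
`HasLefschetzProperty.comp_dual_eq_dual_comp` of `Literature/Algebra/Lie/LefschetzSubmodule.lean`, no `H ≠ 0` needed;
here `comp_nPlus_eq_nPlus_comp_of_comp_eq`). Consequences recorded:

* §1 **morphisms of limit mixed Hodge structures intertwine `H` and `N⁺`** (`Hom.baseChange_comp_deligneH`,
  `Hom.baseChange_comp_nPlus`) — cf. Kato–Usui §6.1.2 (9) for the analogous functoriality of `δ`;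
* §2 **Tate twists** `L(j)` have the same `H` and `N⁺` (`deligneH_tateTwist`, `nPlus_tateTwist`);
* §3 **change of coordinate** `F ↦ e^{zN}F` ((7.5.8)): `H` and `N⁺` are conjugated by `e^{zN_ℂ}`
  (`deligneH_expTwist`, `nPlus_expTwist`) — the triple moves by `Ad(e^{zN})`, as `N` is fixed by it;
* §4 **Deligne's `δ`-splitting** `F ↦ e^{-iδ}F`: `I^{p,q}(e^{-iδ}F) = e^{-iδ} I^{p,q}(F)` (Kerr–Pearlstein (4-5)) and
  `[N, δ] = 0` give `H(F̂) = Ad(e^{-iδ}) H(F)` and **`N⁺(F̂) = Ad(e^{-iδ}) N⁺(F)`** (`deligneH_deltaSplit`,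
  `nPlus_deltaSplit`): the real `𝔰𝔩₂`-triple of the `δ`-splitting is the `e^{-iδ}`-conjugate of the triple of `(W, F, N)`.

Everything is proved; no named fact, no definition, no instance or attribute is introduced (the bracket relations
`lie_nPlus_N`, `lie_deligneH_nPlus` of the tree are only rewritten, never re-synthesised).

## References

* [LooijengaLunts1997] E. Looijenga, V. Lunts, Invent. Math. 129 (1997), §1 (1.1) p. 4 ("this `f` is then unique").
* [CattaniElZeinGriffithsLe2014] E. Cattani et al. (eds.), *Hodge Theory*, Math. Notes 49 (2014), §7.5 (7.5.8),
  (7.5.13)–(7.5.14); Ex. 3.2.23 (4).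
* [KerrPearlstein2011] M. Kerr, G. Pearlstein, in MSRI Publ. 58 (2011), §4.2 (4-4), (4-5).
* [KatoUsui2009] K. Kato, S. Usui, Ann. of Math. Stud. 169 (2009), §6.1.2 (9).
-/

noncomputable section

open scoped TensorProduct

namespace Literature.AlgebraicGeometry.HodgeTheory

open Motives Motives.MixedHodgeStructure
open Motives.HodgeStructure (conj conj_conj complexConj mem_complexConj endConj endConj_apply)
open Literature.Algebra.Lie (degreeSpace mem_degreeSpace_iff IsZGrading HasLefschetzProperty)

universe u

variable {V : Type u} [AddCommGroup V] [Module ℚ V] [FiniteDimensional ℚ V] {k : ℤ}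

namespace LimitMixedHodgeStructure

/-- **A linear map `φ : V_{1,ℂ} → V_{2,ℂ}` intertwining `(H₁, N_{1,ℂ})` with `(H₂, N_{2,ℂ})` intertwines `N₁⁺` with
`N₂⁺`** — the master naturality statement (the partner is a function of `(H, N)` alone).
[cite: LooijengaLunts1997, §1 (1.1) p. 4 L2–L5] [cite: CattaniElZeinGriffithsLe2014, §7.5 (7.5.13)–(7.5.14)] -/
theorem comp_nPlus_eq_nPlus_comp_of_comp_eq {V' : Type u} [AddCommGroup V'] [Module ℚ V'] [FiniteDimensional ℚ V']
    (L₁ : LimitMixedHodgeStructure V k) {k' : ℤ} (L₂ : LimitMixedHodgeStructure V' k')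
    (φ : (ℂ ⊗[ℚ] V) →ₗ[ℂ] (ℂ ⊗[ℚ] V')) (hH : φ ∘ₗ L₁.deligneH = L₂.deligneH ∘ₗ φ)
    (hN : φ ∘ₗ L₁.N.baseChange ℂ = L₂.N.baseChange ℂ ∘ₗ φ) : φ ∘ₗ L₁.nPlus = L₂.nPlus ∘ₗ φ :=
  L₂.hasLefschetzProperty_N.comp_dual_eq_dual_comp L₂.isZGrading_neg_deligneH L₁.hasLefschetzProperty_N
    L₁.isZGrading_neg_deligneH φ (by rw [LinearMap.comp_neg, LinearMap.neg_comp, hH]) hN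

/-! ## §1 Morphisms of limit mixed Hodge structures -/

section Hom

variable {V' : Type u} [AddCommGroup V'] [Module ℚ V'] [FiniteDimensional ℚ V']
  {L₁ : LimitMixedHodgeStructure V k} {L₂ : LimitMixedHodgeStructure V' k}

omit [FiniteDimensional ℚ V] [FiniteDimensional ℚ V'] in
/-- A morphism of limit MHS commutes with `N` after base change: `f_ℂ ∘ N_{1,ℂ} = N_{2,ℂ} ∘ f_ℂ`.
[cite: CattaniElZeinGriffithsLe2014, Def. 7.5.9] -/
theorem Hom.baseChange_comp_N_baseChange (f : Hom L₁ L₂) :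
    f.toLinearMap.baseChange ℂ ∘ₗ L₁.N.baseChange ℂ = L₂.N.baseChange ℂ ∘ₗ f.toLinearMap.baseChange ℂ := by
  rw [← LinearMap.baseChange_comp, ← LinearMap.baseChange_comp, f.comm_N]

/-- **Morphisms of limit mixed Hodge structures intertwine the gradings `H`: `f_ℂ ∘ H₁ = H₂ ∘ f_ℂ`** (they
preserve Deligne's bigrading, `f_ℂ I₁^{p,q} ⊆ I₂^{p,q}`). [cite: CattaniElZeinGriffithsLe2014, §7.5 (7.5.13) and Thm. 7.5.6 ("compatible with all morphisms")]
[cite: KatoUsui2009, §6.1.2 (9)] -/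
theorem Hom.baseChange_comp_deligneH (f : Hom L₁ L₂) :
    f.toLinearMap.baseChange ℂ ∘ₗ L₁.deligneH = L₂.deligneH ∘ₗ f.toLinearMap.baseChange ℂ := by
  rw [deligneH, deligneH, LinearMap.comp_sub, LinearMap.sub_comp, f.toHom.baseChange_comp_deligneY,
    LinearMap.comp_smul, LinearMap.smul_comp, Module.End.one_eq_id, Module.End.one_eq_id, LinearMap.comp_id,
    LinearMap.id_comp]

/-- **Morphisms of limit mixed Hodge structures intertwine `N⁺`: `f_ℂ ∘ N₁⁺ = N₂⁺ ∘ f_ℂ`** (naturality of the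
Jacobson–Morozov partner for `φ = f_ℂ`, which intertwines `(H₁, N₁)` with `(H₂, N₂)`).
[cite: LooijengaLunts1997, §1 (1.1) p. 4 L2–L5] [cite: CattaniElZeinGriffithsLe2014, §7.5 (7.5.13)–(7.5.14)]
[cite: KatoUsui2009, §6.1.2 (9)] -/
theorem Hom.baseChange_comp_nPlus (f : Hom L₁ L₂) :
    f.toLinearMap.baseChange ℂ ∘ₗ L₁.nPlus = L₂.nPlus ∘ₗ f.toLinearMap.baseChange ℂ :=
  L₁.comp_nPlus_eq_nPlus_comp_of_comp_eq L₂ _ f.baseChange_comp_deligneH f.baseChange_comp_N_baseChange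

/-- Pointwise: `f_ℂ (N₁⁺ x) = N₂⁺ (f_ℂ x)`. [cite: LooijengaLunts1997, §1 (1.1) p. 4 L2–L5] -/
theorem Hom.baseChange_nPlus_apply (f : Hom L₁ L₂) (x : ℂ ⊗[ℚ] V) :
    f.toLinearMap.baseChange ℂ (L₁.nPlus x) = L₂.nPlus (f.toLinearMap.baseChange ℂ x) :=
  LinearMap.congr_fun f.baseChange_comp_nPlus x

end Hom

/-- **Endomorphisms of a limit MHS commute with its `𝔰𝔩₂`-triple**: `g_ℂ N⁺ = N⁺ g_ℂ` for every `g : L → L`.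
[cite: LooijengaLunts1997, §1 (1.1) p. 4 L2–L5] [cite: KatoUsui2009, §6.1.2 (9)] -/
theorem Hom.commute_baseChange_nPlus {L : LimitMixedHodgeStructure V k} (g : Hom L L) :
    Commute (g.toLinearMap.baseChange ℂ) L.nPlus :=
  g.baseChange_comp_nPlus

/-! ## §2 Tate twists -/

variable (L : LimitMixedHodgeStructure V k)

/-- **`H(L(j)) = H(L)`**: the Tate twist shifts `I^{p,q}` to `I^{p+j,q+j}` and the weight `k` to `k - 2j`, so
`H = Y - k` is unchanged. [cite: CattaniElZeinGriffithsLe2014, Ex. 3.2.23 (4) and §7.5 (7.5.13)] -/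
theorem deligneH_tateTwist (j : ℤ) : (L.tateTwist j).deligneH = L.deligneH := by
  refine (L.tateTwist j).toMixedHodgeStructure.linearMap_eq_of_eqOn_deligneI fun p q x hx => ?_
  have hx' : x ∈ L.toMixedHodgeStructure.deligneI (p + j) (q + j) := by
    rw [tateTwist_toMixedHodgeStructure, MixedHodgeStructure.deligneI_tateTwist] at hx
    exact hx
  rw [(L.tateTwist j).deligneH_apply_of_mem hx, L.deligneH_apply_of_mem hx']
  congr 1
  push_cast
  ring

/-- **`N⁺(L(j)) = N⁺(L)`** (same `H`, same `N`; uniqueness). [cite: CattaniElZeinGriffithsLe2014, Ex. 3.2.23 (4) and §7.5 (7.5.13)–(7.5.14)]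
[cite: LooijengaLunts1997, §1 (1.1) p. 4 L2–L5] -/
theorem nPlus_tateTwist (j : ℤ) : (L.tateTwist j).nPlus = L.nPlus := by
  symm
  refine (L.tateTwist j).eq_nPlus_of_lie_eq ?_ ?_
  · rw [tateTwist_N, deligneH_tateTwist, L.lie_nPlus_N]
  · rw [deligneH_tateTwist, L.lie_deligneH_nPlus]

/-! ## §3 Change of coordinate `F ↦ e^{zN_ℂ}F` -/

omit [FiniteDimensional ℚ V] in
/-- `z N_ℂ ∈ Λ^{-1,-1}`. [cite: CattaniElZeinGriffithsLe2014, Def. 7.5.9 (N of type (-1,-1))] -/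
theorem smul_N_baseChange_mem_lambda (z : ℂ) : z • L.N.baseChange ℂ ∈ L.toMixedHodgeStructure.lambda :=
  L.toMixedHodgeStructure.lambda.smul_mem z L.N_baseChange_mem_lambda

omit [FiniteDimensional ℚ V] in
/-- The underlying MHS of the coordinate change `L.expTwist z` is the tree's `lambdaTwist` by `zN_ℂ ∈ Λ^{-1,-1}` (same
`W`, `F ↦ e^{zN_ℂ}F`). [cite: CattaniElZeinGriffithsLe2014, §7.5 (7.5.8)] -/
theorem expTwist_toMixedHodgeStructure_eq_lambdaTwist (z : ℂ) :
    (L.expTwist z).toMixedHodgeStructure = L.toMixedHodgeStructure.lambdaTwist (L.smul_N_baseChange_mem_lambda z) :=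
  rfl

omit [FiniteDimensional ℚ V] in
/-- **Deligne's bigrading moves with the coordinate: `I^{p,q}(W, e^{zN}F) = e^{zN_ℂ} I^{p,q}(W, F)`** (Kerr–Pearlstein
(4-5) with `λ = zN_ℂ ∈ Λ^{-1,-1}`). [cite: KerrPearlstein2011, §4.2 (4-5)] [cite: CattaniElZeinGriffithsLe2014, §7.5 (7.5.8)] -/
theorem deligneI_expTwist (z : ℂ) (p q : ℤ) :
    (L.expTwist z).toMixedHodgeStructure.deligneI p q =
      (L.toMixedHodgeStructure.deligneI p q).map (IsNilpotent.exp (z • L.N.baseChange ℂ)) := by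
  rw [expTwist_toMixedHodgeStructure_eq_lambdaTwist]
  exact L.toMixedHodgeStructure.deligneI_lambdaTwist (L.smul_N_baseChange_mem_lambda z) p q

/-- **`H(W, e^{zN}F) = e^{zN_ℂ} H(W, F) e^{-zN_ℂ}`.** [cite: CattaniElZeinGriffithsLe2014, §7.5 (7.5.8) and (7.5.13)]
[cite: KerrPearlstein2011, §4.2 (4-5)] -/
theorem deligneH_expTwist (z : ℂ) :
    (L.expTwist z).deligneH = IsNilpotent.exp (z • L.N.baseChange ℂ) * L.deligneH *
      IsNilpotent.exp (-(z • L.N.baseChange ℂ)) := by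
  have hn : IsNilpotent (z • L.N.baseChange ℂ) := L.isNilpotent_N_baseChange.smul z
  rw [deligneH, deligneH, expTwist_toMixedHodgeStructure_eq_lambdaTwist,
    L.toMixedHodgeStructure.deligneY_lambdaTwist (L.smul_N_baseChange_mem_lambda z), mul_sub, sub_mul,
    mul_smul_comm, smul_mul_assoc, mul_one, IsNilpotent.exp_mul_exp_neg_self hn]

omit [FiniteDimensional ℚ V] in
/-- `e^{zN_ℂ}` commutes with `N_ℂ`. [cite: CattaniElZeinGriffithsLe2014, §7.5 (7.5.8)] -/
theorem exp_smul_N_comp_N (z : ℂ) :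
    IsNilpotent.exp (z • L.N.baseChange ℂ) ∘ₗ L.N.baseChange ℂ =
      L.N.baseChange ℂ ∘ₗ IsNilpotent.exp (z • L.N.baseChange ℂ) :=
  Module.End.commute_exp_left_of_commute (L.isNilpotent_N_baseChange.smul z) (L.isNilpotent_N_baseChange.smul z)
    (by rw [LinearMap.smul_comp, LinearMap.comp_smul])

/-- **`e^{zN_ℂ}` intertwines the `N⁺`: `e^{zN_ℂ} ∘ N⁺(F) = N⁺(e^{zN}F) ∘ e^{zN_ℂ}`.** [cite: LooijengaLunts1997, §1 (1.1) p. 4 L2–L5]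
[cite: CattaniElZeinGriffithsLe2014, §7.5 (7.5.8) and (7.5.13)–(7.5.14)] -/
theorem exp_smul_N_comp_nPlus (z : ℂ) :
    IsNilpotent.exp (z • L.N.baseChange ℂ) ∘ₗ L.nPlus = (L.expTwist z).nPlus ∘ₗ IsNilpotent.exp (z • L.N.baseChange ℂ) := by
  have hn : IsNilpotent (z • L.N.baseChange ℂ) := L.isNilpotent_N_baseChange.smul z
  refine L.comp_nPlus_eq_nPlus_comp_of_comp_eq (L.expTwist z) _ ?_ ?_
  · rw [deligneH_expTwist, ← Module.End.mul_eq_comp, ← Module.End.mul_eq_comp, mul_assoc, mul_assoc,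
      IsNilpotent.exp_neg_mul_exp_self hn, mul_one]
  · rw [expTwist_N]
    exact L.exp_smul_N_comp_N z

/-- **`N⁺(W, e^{zN}F) = e^{zN_ℂ} N⁺(W, F) e^{-zN_ℂ}`**: under the change of coordinate the whole `𝔰𝔩₂`-triple moves by
`Ad(e^{zN_ℂ})` (which fixes `N`). [cite: CattaniElZeinGriffithsLe2014, §7.5 (7.5.8) and (7.5.13)–(7.5.14)]
[cite: LooijengaLunts1997, §1 (1.1) p. 4 L2–L5] -/
theorem nPlus_expTwist (z : ℂ) :
    (L.expTwist z).nPlus = IsNilpotent.exp (z • L.N.baseChange ℂ) * L.nPlus * IsNilpotent.exp (-(z • L.N.baseChange ℂ)) := by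
  have hn : IsNilpotent (z • L.N.baseChange ℂ) := L.isNilpotent_N_baseChange.smul z
  have h := L.exp_smul_N_comp_nPlus z
  rw [← Module.End.mul_eq_comp, ← Module.End.mul_eq_comp] at h
  rw [h, mul_assoc, IsNilpotent.exp_mul_exp_neg_self hn, mul_one]

/-! ## §4 Deligne's `δ`-splitting: `N⁺(F̂) = Ad(e^{-iδ}) N⁺(F)` -/

/-- **`H(W, e^{-iδ}F) = e^{-iδ} H(W, F) e^{iδ}`** (`I^{p,q}(e^{-iδ}F) = e^{-iδ} I^{p,q}(F)`, Kerr–Pearlstein (4-5)).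
[cite: KerrPearlstein2011, §4.2 (4-5)] [cite: CattaniElZeinGriffithsLe2014, §7.5 (7.5.13)] -/
theorem deligneH_deltaSplit :
    L.deltaSplit.deligneH = IsNilpotent.exp (-Complex.I • L.toMixedHodgeStructure.delta) * L.deligneH *
      IsNilpotent.exp (-(-Complex.I • L.toMixedHodgeStructure.delta)) := by
  have hn : IsNilpotent (-Complex.I • L.toMixedHodgeStructure.delta) := L.toMixedHodgeStructure.isNilpotent_delta.smul _
  have hY : L.toMixedHodgeStructure.deltaSplit.deligneY =
      IsNilpotent.exp (-Complex.I • L.toMixedHodgeStructure.delta) * L.toMixedHodgeStructure.deligneY *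
        IsNilpotent.exp (-(-Complex.I • L.toMixedHodgeStructure.delta)) :=
    L.toMixedHodgeStructure.deligneY_lambdaTwist L.toMixedHodgeStructure.neg_I_smul_delta_mem_lambda
  rw [deligneH, deligneH, deltaSplit_toMixedHodgeStructure, hY, mul_sub, sub_mul, mul_smul_comm, smul_mul_assoc, mul_one,
    IsNilpotent.exp_mul_exp_neg_self hn]

/-- **`e^{-iδ}` intertwines the `N⁺`: `e^{-iδ} ∘ N⁺(F) = N⁺(F̂) ∘ e^{-iδ}`** (`e^{-iδ}` intertwines `H` by the previous
lemma and commutes with `N` as `[N, δ] = 0`). [cite: LooijengaLunts1997, §1 (1.1) p. 4 L2–L5] [cite: KatoUsui2009, §6.1.2 (9)]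
[cite: KerrPearlstein2011, §4.2 (4-5)] -/
theorem exp_neg_I_smul_delta_comp_nPlus :
    IsNilpotent.exp (-Complex.I • L.toMixedHodgeStructure.delta) ∘ₗ L.nPlus =
      L.deltaSplit.nPlus ∘ₗ IsNilpotent.exp (-Complex.I • L.toMixedHodgeStructure.delta) := by
  have hn : IsNilpotent (-Complex.I • L.toMixedHodgeStructure.delta) := L.toMixedHodgeStructure.isNilpotent_delta.smul _
  refine L.comp_nPlus_eq_nPlus_comp_of_comp_eq L.deltaSplit _ ?_ ?_
  · rw [deligneH_deltaSplit, ← Module.End.mul_eq_comp, ← Module.End.mul_eq_comp, mul_assoc, mul_assoc,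
      IsNilpotent.exp_neg_mul_exp_self hn, mul_one]
  · rw [deltaSplit_N]
    exact (L.N_baseChange_comp_exp_neg_I_smul_delta).symm

/-- **`N⁺(F̂) = e^{-iδ} N⁺(F) e^{iδ}`: the (real) `𝔰𝔩₂`-triple of Deligne's `δ`-splitting `(W, e^{-iδ}F, N)` is the
`Ad(e^{-iδ})`-conjugate of the triple of `(W, F, N)`.** [cite: KerrPearlstein2011, §4.2 (4-5)] [cite: CattaniElZeinGriffithsLe2014, §7.5 (7.5.13)–(7.5.14)]
[cite: LooijengaLunts1997, §1 (1.1) p. 4 L2–L5] -/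
theorem nPlus_deltaSplit :
    L.deltaSplit.nPlus = IsNilpotent.exp (-Complex.I • L.toMixedHodgeStructure.delta) * L.nPlus *
      IsNilpotent.exp (-(-Complex.I • L.toMixedHodgeStructure.delta)) := by
  have hn : IsNilpotent (-Complex.I • L.toMixedHodgeStructure.delta) := L.toMixedHodgeStructure.isNilpotent_delta.smul _
  have h := L.exp_neg_I_smul_delta_comp_nPlus
  rw [← Module.End.mul_eq_comp, ← Module.End.mul_eq_comp] at h
  rw [h, mul_assoc, IsNilpotent.exp_mul_exp_neg_self hn, mul_one]

end LimitMixedHodgeStructure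

end Literature.AlgebraicGeometry.HodgeTheory

end
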